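import Summits.BirchSwinnertonDyer.BirchSwinnertonDyer.Theorems.ManinLocalTwoThreeFormalKummerDoubling
import Literature.NumberTheory.EllipticCurves.FormalLogExpBaseChangeProofs
import Literature.NumberTheory.EllipticCurves.CuspFormLFunctionLevelConductorProofs
import Literature.NumberTheory.EllipticCurves.QuadraticTwistAtTwoMinimalModelProofs
import Literature.NumberTheory.EllipticCurves.SzpiroLocalDataProofs
import Literature.NumberTheory.EllipticCurves.ModularCurveManinSemistableCoprimeFormProofs
import Literature.NumberTheory.EllipticCurves.ModularCurveManinConstantProofs
import HarnessLib

/-!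
# E-an-47 `EvenManinKummerSquare` PROVED: an even Manin constant squares the cuspidal Kummer class

Summit `BirchSwinnertonDyer`, route `ManinLocalTwoThree` (cell bsd-f2-manin), deciding crux C2
`ManinOddAtFour` (stmt-BirchSwinnertonDyer-22967), reducible residual `Rb` of the line `kato_shift_two`
(lead p1).  The an planner (MEMO-an §56) proposed a `c`-free, Euler-system-free CERTIFICATE for `Rb`:
the cuspidal Kummer class of a rational 2-torsion point `T = (e, ·)`.  Its support row E-an-47
(`…Rank1Residual.ManinAdditive.CuspidalKummer.EvenManinKummerSquare`, typed leaf `CuspidalKummerClass`,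
REF1 §R50 «theorem-grade») is proved here BY NAME, unconditionally:

  `EvenManinKummerSquare_holds : EvenManinKummerSquare`

— for globally minimal elliptic `W`, a modular parametrisation datum `D` at a level `N` with `4 ∣ N`,
integral newform coefficients `aₙ`, a rational root `e` of the 2-division polynomial and the formal germ
`z` of the short model `E_{W,c}` (`log_{E_{W,c}}(z) = Σ aₙqⁿ/n`, `c = D.c`): `2 ∣ c ⇒` the Kummer
series `Ξ_T = X_{E_{W,c}}(z) − c²(e + b₂/12)z²` is a square in `Frac ℤ₂⟦q⟧`.

PROOF (an's sketch, with two simplifications that make it unconditional in the tree): (§5) `4 ∣ N`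
gives `a₂(f) = 0` (Atkin–Lehner, `IsNewform0.cuspCoeff_eq_zero_of_sq_dvd`) and `2 ∣ N_W`
(`IsNewformOf.dvd_level_iff_dvd_conductorNorm`), hence `aₙ(W) = 0` for all even `n` ((8.44) +
multiplicativity) and ADDITIVE reduction at `2` (`a_p = ±1` at multiplicative `p`), hence `a₁, a₃` of
the minimal equation are even (Kraus parities: `a₁` odd ⇒ `c₄` odd; `a₁` even, `a₃` odd ⇒ `Δ` odd),
so `16 ∣ c₄`, `32 ∣ c₆` and the plain short model `E♮ : y² = x³ − (c₄/48)x − c₆/864` is `2`-INTEGRAL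
with `a₁ = a₃ = 0` — no Honda input is needed at the additive prime: `log_{E♮}, exp_{E♮} ∈ ℤ₂⟦T⟧` by
parity (`ManinLocalTwoThreeFormalKummerDoubling` §2); (§6) `E_{W,c} = (c⁻¹,0,0,0) • E♮` turns the
germ into `log_{E♮}(c·z) = c·L`, `L = Σ aₙqⁿ/n ∈ ℤ₂⟦q⟧`; with `c = 2c′`, `s := exp_{E♮}(c′L) ∈
qℤ₂⟦q⟧` and `c·z = [2](s)`; the formal `2`-descent square gives `Ξ·(2sX(s))² = ([2]s · N)²` with
`N = (X(s) − e♮s²)² − f′(e♮)s⁴`, everything `2`-integral (`e♮ = e + b₂/12` is a root of the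
`2`-integral monic cubic, hence a `2`-adic integer), and `2sX(s) ≠ 0` (`a₁(W) = 1`, `c ≠ 0` by
`maninConstant_ne_zero_holds`).

HONEST FRAMING: this is the SUPPORT row E-an-47 of an's certificate (E-an-52 = 47 ∧ 49⁺ ∧ UFD; 49⁺ is
the tree theorem `EtaUnitSquareIffEven_holds`); the crux K_geo (E-an-48) and the deciding row E-an-53 stay
open; nothing about BSD, about Manin's conjecture, or about the parity of any actual Manin constant is
proved here.
-/

set_option autoImplicit false
set_option linter.dupNamespace false

noncomputable section

open scoped Classical MatrixGroups ModularForm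
open PowerSeries CongruenceSubgroup IsDedekindDomain NumberField Rat.HeightOneSpectrum
open WeierstrassCurve Literature.NumberTheory.EllipticCurves Literature.NumberTheory.EllipticCurves.ModularForms
  Literature.RingTheory.FormalGroups
open Summit.BirchSwinnertonDyer.Rank1Residual.ManinAdditive.CuspidalKummer

namespace Summit.BirchSwinnertonDyer.BirchSwinnertonDyer.Theorems.ManinLocalTwoThree

/-! ### §5 Arithmetic at `2` -/

section Arith

variable {N : ℕ} [NeZero N] (W : WeierstrassCurve ℚ) [W.IsElliptic]

/-- **`4 ∣ N ⇒ a₂(E) = 0` and `2 ∣ N_E`** for the newform of `E` at level `N` (Atkin–Lehner 1970,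
Thm. 3: `p² ∣ N ⇒ a_p(f) = 0`; `aₙ(f) = aₙ(E)`; the level and the conductor share their primes).
[cite: AtkinLehner1970, Thm. 3] -/
theorem lFunction_two_eq_zero_of_four_dvd {f : CuspForm (Gamma0 N) 2} (hf : IsNewformOf W f)
    (h4 : 4 ∣ N) : W.LFunction 2 = 0 ∧ 2 ∣ W.conductorNorm ℤ := by
  have h22 : 2 ^ 2 ∣ N := by norm_num; exact h4
  have h0 := hf.1.cuspCoeff_eq_zero_of_sq_dvd Nat.prime_two h22
  rw [hf.2 2] at h0
  refine ⟨by exact_mod_cast h0, (hf.dvd_level_iff_dvd_conductorNorm Nat.prime_two).mp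
    (dvd_trans ⟨2, by norm_num⟩ h4)⟩

/-- **`aₙ(E) = 0` for every even `n ≥ 1`** once `a₂(E) = 0` and `2 ∣ N_E` (`a_{2^{k+2}} =
a₂a_{2^{k+1}} − 𝟙_{N_E}(2)·2·a_{2^k}`, multiplicativity). [cite: DiamondShurman2005, (8.44)] -/
theorem lFunction_eq_zero_of_even (h2 : W.LFunction 2 = 0) (hN : 2 ∣ W.conductorNorm ℤ)
    {n : ℕ} (hn0 : n ≠ 0) (hn : 2 ∣ n) : W.LFunction n = 0 := by
  obtain ⟨k, m, hm, rfl⟩ := Nat.exists_eq_two_pow_mul_odd hn0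
  have hk : k ≠ 0 := by
    rintro rfl; rw [pow_zero, one_mul] at hn; exact hm.not_two_dvd_nat hn
  have hpow : ∀ j : ℕ, W.LFunction (2 ^ (j + 1)) = 0 := by
    intro j
    induction j with
    | zero => rw [zero_add, pow_one]; exact h2
    | succ j ih =>
      rw [show j + 1 + 1 = j + 2 by ring, W.LFunction_apply_prime_pow_add_two_of_prime Nat.prime_two j,
        if_pos hN, h2, ih]
      ring
  have hcop : Nat.Coprime (2 ^ k) m :=
    (Nat.coprime_two_left.mpr hm).pow_left k |>.symm.symm
  obtain ⟨j, rfl⟩ := Nat.exists_eq_succ_of_ne_zero hk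
  rw [W.isMultiplicative_LFunction.map_mul_of_coprime hcop, hpow j, zero_mul]

/-- **Additive reduction at `2` from `a₂(E) = 0` and `2 ∣ N_E`**: the place over `2` is bad, and a
multiplicative place would have `a₂(E) = ±1`. [cite: SilvermanAEC2009, §C.16 (definition of L_v(T))] -/
theorem hasAdditiveReductionAt_two_of_lFunction_two_eq_zero (h2 : W.LFunction 2 = 0)
    (hN : 2 ∣ W.conductorNorm ℤ) :
    W.HasAdditiveReductionAt ((primesEquiv (R := 𝓞 ℚ)).symm ⟨2, Nat.prime_two⟩) := by
  set v : HeightOneSpectrum (𝓞 ℚ) := (primesEquiv (R := 𝓞 ℚ)).symm ⟨2, Nat.prime_two⟩ with hv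
  have hpv : primesEquiv v = ⟨2, Nat.prime_two⟩ := (primesEquiv (R := 𝓞 ℚ)).apply_symm_apply _
  have hbad : ¬ W.HasGoodReductionAt v :=
    W.not_hasGoodReductionAt_ringOfIntegers_of_dvd_conductorNorm ⟨2, Nat.prime_two⟩ hN
  rcases hasGoodReductionAt_or_hasMultiplicativeReductionAt_or_hasAdditiveReductionAt v W with
    hg | hm | ha
  · exact absurd hg hbad
  · exfalso
    by_cases hs : W.HasSplitMultiplicativeReductionAt v
    · have h := W.LFunction_apply_primesEquiv_of_hasSplitMultiplicativeReductionAt hs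
      rw [hpv] at h; change W.LFunction 2 = 1 at h; rw [h2] at h; exact zero_ne_one h
    · have h := W.LFunction_apply_primesEquiv_of_hasMultiplicativeReductionAt_of_not_split hm hs
      rw [hpv] at h; change W.LFunction 2 = -1 at h; rw [h2] at h; norm_num at h
  · exact ha

/-- **At an additive place `2`, the minimal equation has `a₁` and `a₃` even** (`2 ∣ c₄` and
`2 ∣ Δ`; `a₁` odd gives `c₄` odd, `a₁` even with `a₃` odd gives `Δ` odd). Silverman *AEC* VII.5.1,
Kraus 1989 Prop. 2 parities. [cite: Kraus1989, Prop. 2] -/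
theorem even_a₁_and_even_a₃_of_hasAdditiveReductionAt_two [W.IsGloballyMinimal]
    (ha : W.HasAdditiveReductionAt ((primesEquiv (R := 𝓞 ℚ)).symm ⟨2, Nat.prime_two⟩)) :
    Even (integralModelInt W).a₁ ∧ Even (integralModelInt W).a₃ := by
  set M : WeierstrassCurve ℤ := integralModelInt W with hM
  have hWM : M.map (Int.castRingHom ℚ) = W := map_integralModelInt W
  set v : HeightOneSpectrum ℤ := (primesEquiv (R := ℤ)).symm ⟨2, Nat.prime_two⟩ with hv
  have haZ : W.HasAdditiveReductionAt v :=
    (W.hasAdditiveReductionAt_int_iff_ringOfIntegers ⟨2, Nat.prime_two⟩).mpr ha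
  have hgen : natGenerator v = 2 :=
    Literature.NumberTheory.EllipticCurves.Rat.natGenerator_primesEquiv_symm ⟨2, Nat.prime_two⟩
  have hgen2 : (natGenerator v : ℤ) = 2 := by exact_mod_cast hgen
  have hmin : W.IsMinimalAt v := IsGloballyMinimal.isMinimalAt_int W v
  obtain ⟨hΔ, hc₄⟩ := (hasAdditiveReductionAt_iff_of_isMinimalAt hmin).mp haZ
  rw [← hWM, map_Δ, eq_intCast,
    Literature.NumberTheory.EllipticCurves.Rat.valuation_intCast_lt_one_iff v, hgen2] at hΔ
  rw [← hWM, map_c₄, eq_intCast,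
    Literature.NumberTheory.EllipticCurves.Rat.valuation_intCast_lt_one_iff v, hgen2] at hc₄
  have h₁ : Even M.a₁ := by
    by_contra h; exact odd_c₄_of_odd_a₁ M (Int.not_even_iff_odd.mp h) hc₄
  exact ⟨h₁, by by_contra h; exact odd_Δ_of_even_a₁_of_odd_a₃ M h₁ (Int.not_even_iff_odd.mp h) hΔ⟩

/-- `a₁ = 2x`, `a₃ = 2y` ⟹ `32 ∣ c₆` (indeed `c₆ = 32(−2β³ + 9βδ − 27ε)` with `β = x² + a₂`,
`δ = a₄ + 2xy`, `ε = y² + a₆`). [cite: Kraus1989, Prop. 2] -/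
theorem c₆_eq_of_even_a₁_of_even_a₃
    (M : WeierstrassCurve ℤ) {x y : ℤ} (hx : M.a₁ = x + x) (hy : M.a₃ = y + y) :
    M.c₆ = 32 * (-2 * (x ^ 2 + M.a₂) ^ 3 + 9 * (x ^ 2 + M.a₂) * (M.a₄ + 2 * x * y) -
      27 * (y ^ 2 + M.a₆)) := by
  simp only [WeierstrassCurve.c₆, WeierstrassCurve.b₂, WeierstrassCurve.b₄, WeierstrassCurve.b₆, hx, hy]
  ring

/-- `a₁ = 2x`, `a₃ = 2y` ⟹ `c₄ = 16((x² + a₂)² − 3(a₄ + 2xy))`. [cite: Kraus1989, Prop. 2] -/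
theorem c₄_eq_of_even_a₁_of_even_a₃
    (M : WeierstrassCurve ℤ) {x y : ℤ} (hx : M.a₁ = x + x) (hy : M.a₃ = y + y) :
    M.c₄ = 16 * ((x ^ 2 + M.a₂) ^ 2 - 3 * (M.a₄ + 2 * x * y)) := by
  simp only [WeierstrassCurve.c₄, WeierstrassCurve.b₂, WeierstrassCurve.b₄, hx, hy]
  ring

end Arith

/-! ### §6 E-an-47: an even Manin constant squares the Kummer class -/

section Main

/-- A root of a monic cubic `x³ + Ax + B` with `p`-integral `A, B` is `p`-integral (ultrametric
inequality: `‖e‖³ ≤ max(‖e‖, 1)`). [folklore] -/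
theorem padic_norm_le_one_of_cubic_root {p : ℕ} [Fact p.Prime] {e A B : ℚ_[p]} (hA : ‖A‖ ≤ 1)
    (hB : ‖B‖ ≤ 1) (h : e ^ 3 + A * e + B = 0) : ‖e‖ ≤ 1 := by
  by_contra hlt
  rw [not_le] at hlt
  have he3 : e ^ 3 = -(A * e + B) := by linear_combination h
  have h1 : ‖e‖ ^ 3 ≤ ‖e‖ := by
    calc ‖e‖ ^ 3 = ‖e ^ 3‖ := (norm_pow e 3).symm
      _ = ‖A * e + B‖ := by rw [he3, norm_neg]
      _ ≤ max ‖A * e‖ ‖B‖ := Padic.nonarchimedean _ _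
      _ ≤ max ‖e‖ 1 := max_le_max (by rw [norm_mul]; exact mul_le_of_le_one_left (norm_nonneg _) hA) hB
      _ = ‖e‖ := max_eq_left hlt.le
  have hpos : 0 < ‖e‖ := lt_trans zero_lt_one hlt
  have h2 : ‖e‖ ^ 2 ≤ 1 := by
    rw [pow_succ] at h1
    nlinarith
  nlinarith

/-- **Theorem E-an-47 (`EvenManinKummerSquare`, cell bsd-f2-manin, MEMO-an §56; row of
`…ManinAdditive.CuspidalKummerClass`), PROVED: an even Manin constant squares the cuspidal Kummer class.**
For globally minimal elliptic `W`, `D : ModularParametrizationData W N`, `4 ∣ N`, integral newform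
coefficients `aₙ`, a rational root `e` of the 2-division polynomial and the formal germ `z` of `E_{W,c}`
(`c = D.c`): `2 ∣ c ⇒ Ξ_T = X_{E_{W,c}}(z) − c²(e + b₂/12)z²` is a square in `Frac ℤ₂⟦q⟧`.  Proof in
the module docstring (§5 arithmetic at `2`; `ManinLocalTwoThreeFormalKummerDoubling` §§1–4).  Nothing
about BSD, Manin's conjecture or the parity of an actual Manin constant is asserted; `IsParamGerm` is an
input. [cite: SilvermanAEC2009, X.1 Prop. 1.4 (shape only: the 2-descent square `x(2Q) − e`; the q-expansion statement is the cell's, MEMO-an §56)] -/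
theorem EvenManinKummerSquare_holds : EvenManinKummerSquare := by
  intro W hWell hWmin N hN D a ha h4 e he z hz h2c
  obtain ⟨hz0, hlog⟩ := hz
  have hc0 : D.c ≠ 0 := D.maninConstant_ne_zero_holds
  obtain ⟨c', hc'⟩ := h2c
  -- §5: arithmetic at `2`
  obtain ⟨ha2, hN2⟩ := lFunction_two_eq_zero_of_four_dvd W D.isNewformOf h4
  have hadd := hasAdditiveReductionAt_two_of_lFunction_two_eq_zero W ha2 hN2
  obtain ⟨⟨x, hx⟩, ⟨y, hy⟩⟩ := even_a₁_and_even_a₃_of_hasAdditiveReductionAt_two W hadd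
  set M : WeierstrassCurve ℤ := integralModelInt W with hM
  have hWM : M.map (Int.castRingHom ℚ) = W := map_integralModelInt W
  have han : ∀ n, a n = W.LFunction n := fun n => by
    have h := ha n; rw [D.isNewformOf.2 n] at h; exact_mod_cast h
  -- the `2`-integral short model `E♮ = shortModel W 1` over `ℤ_[2]`
  set κ : ℤ := (x ^ 2 + M.a₂) ^ 2 - 3 * (M.a₄ + 2 * x * y) with hκ
  set μ : ℤ := -2 * (x ^ 2 + M.a₂) ^ 3 + 9 * (x ^ 2 + M.a₂) * (M.a₄ + 2 * x * y) -
    27 * (y ^ 2 + M.a₆) with hμ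
  have hWc₄ : W.c₄ = ((16 * κ : ℤ) : ℚ) := by
    rw [← hWM, map_c₄, c₄_eq_of_even_a₁_of_even_a₃ M hx hy]; simp [hκ]
  have hWc₆ : W.c₆ = ((32 * μ : ℤ) : ℚ) := by
    rw [← hWM, map_c₆, c₆_eq_of_even_a₁_of_even_a₃ M hx hy]; simp [hμ]
  have ha₄ : (shortModel W 1).a₄ = -((κ : ℚ) / 3) := by
    simp only [shortModel, hWc₄]; push_cast; ring
  have ha₆ : (shortModel W 1).a₆ = -((μ : ℚ) / 27) := by
    simp only [shortModel, hWc₆]; push_cast; ring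
  have h3 : ‖((3 : ℕ) : ℚ_[2])⁻¹‖ = 1 := padicTwo_norm_inv_natCast_of_odd (by decide)
  have h27 : ‖((27 : ℕ) : ℚ_[2])⁻¹‖ = 1 := padicTwo_norm_inv_natCast_of_odd (by decide)
  have hrat : ∀ q : ℚ, algebraMap ℚ ℚ_[2] q = (q : ℚ_[2]) := fun q => by rw [eq_ratCast]
  have hA : ‖algebraMap ℚ ℚ_[2] (shortModel W 1).a₄‖ ≤ 1 := by
    rw [hrat, ha₄]; push_cast
    rw [norm_neg, div_eq_mul_inv, norm_mul, show (3 : ℚ_[2]) = ((3 : ℕ) : ℚ_[2]) by norm_cast, h3,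
      mul_one]
    exact Padic.norm_int_le_one κ
  have hB : ‖algebraMap ℚ ℚ_[2] (shortModel W 1).a₆‖ ≤ 1 := by
    rw [hrat, ha₆]; push_cast
    rw [norm_neg, div_eq_mul_inv, norm_mul, show (27 : ℚ_[2]) = ((27 : ℕ) : ℚ_[2]) by norm_cast, h27,
      mul_one]
    exact Padic.norm_int_le_one μ
  set A₀ : ℤ_[2] := ⟨_, hA⟩ with hA₀
  set B₀ : ℤ_[2] := ⟨_, hB⟩ with hB₀
  set V : WeierstrassCurve ℤ_[2] := ⟨0, 0, 0, A₀, B₀⟩ with hVdef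
  have hVE : V.map PadicInt.Coe.ringHom = (shortModel W 1).map (algebraMap ℚ ℚ_[2]) := by
    ext <;> simp [hVdef, shortModel, hA₀, hB₀]
  -- ellipticity of the generic fibre: `Δ(E♮) = Δ(W) ≠ 0`
  have hΔ1 : (shortModel W 1).Δ = W.Δ := by
    have hc := W.c_relation
    simp only [shortModel, WeierstrassCurve.Δ, WeierstrassCurve.b₂, WeierstrassCurve.b₄,
      WeierstrassCurve.b₆, WeierstrassCurve.b₈, Int.cast_one, one_pow, one_mul] at hc ⊢
    simp only [WeierstrassCurve.c₄, WeierstrassCurve.c₆, WeierstrassCurve.b₂, WeierstrassCurve.b₄,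
      WeierstrassCurve.b₆] at hc ⊢
    linear_combination (1 / 1728 : ℚ) * hc
  haveI hEll : (V.map PadicInt.Coe.ringHom).IsElliptic := by
    rw [hVE]
    refine ⟨?_⟩
    rw [map_Δ, hΔ1, isUnit_iff_ne_zero]
    exact (map_ne_zero _).mpr hWell.isUnit.ne_zero
  haveI hInt : (V.map PadicInt.Coe.ringHom).IsIntegral ℤ_[2] := V.isIntegral_map_coe
  -- the 2-torsion abscissa `e♮ = e + b₂/12` on `E♮`, a `2`-adic integer
  set eQ : ℚ := shortRoot W 1 e with heQ
  set e₂ : ℚ_[2] := algebraMap ℚ ℚ_[2] eQ with he₂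
  have heroot : eQ ^ 3 + (shortModel W 1).a₂ * eQ ^ 2 + (shortModel W 1).a₄ * eQ +
      (shortModel W 1).a₆ = 0 := shortRoot_one_isRoot W he
  have ha₂0 : (shortModel W 1).a₂ = 0 := rfl
  have heroot₂ : e₂ ^ 3 + (V.a₂ : ℚ_[2]) * e₂ ^ 2 + (V.a₄ : ℚ_[2]) * e₂ + (V.a₆ : ℚ_[2]) = 0 := by
    have h := congrArg (algebraMap ℚ ℚ_[2]) heroot
    simp only [map_add, map_mul, map_pow, map_zero, ha₂0, zero_mul, add_zero] at h
    have h2 : (V.a₂ : ℚ_[2]) = 0 := by simp [hVdef]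
    rw [h2, zero_mul, add_zero]
    exact h
  have henorm : ‖e₂‖ ≤ 1 := by
    refine padic_norm_le_one_of_cubic_root (A := (V.a₄ : ℚ_[2])) (B := (V.a₆ : ℚ_[2]))
      (PadicInt.norm_le_one _) (PadicInt.norm_le_one _) ?_
    have h := heroot₂
    simp only [hVdef, PadicInt.coe_zero, zero_mul, add_zero] at h ⊢
    linear_combination h
  -- §C: the germ, read on `E♮ ⊗ ℚ₂`
  set ι : ℚ⟦X⟧ →+* ℚ_[2]⟦X⟧ := PowerSeries.map (algebraMap ℚ ℚ_[2]) with hι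
  set z₂ : ℚ_[2]⟦X⟧ := ι z with hz₂
  set L₂ : ℚ_[2]⟦X⟧ := ι (lSeriesLog a) with hL₂
  set D₂ : ℚ_[2]⟦X⟧ := C ((D.c : ℚ) : ℚ_[2]) * z₂ with hD₂
  have hcz0 : constantCoeff (C (D.c : ℚ) * z) = 0 := by rw [map_mul, hz0, mul_zero]
  have hlog1 : (shortModel W 1).formalLog.subst (C (D.c : ℚ) * z) = C (D.c : ℚ) * lSeriesLog a := by
    have h := formalLog_shortModel_subst W hc0 hz0
    rw [hlog] at h
    have hcc : (C (D.c : ℚ) : ℚ⟦X⟧) * C (D.c : ℚ)⁻¹ = 1 := by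
      rw [← map_mul, mul_inv_cancel₀ (Int.cast_ne_zero.mpr hc0), map_one]
    calc (shortModel W 1).formalLog.subst (C (D.c : ℚ) * z)
        = C (D.c : ℚ) * C (D.c : ℚ)⁻¹ * (shortModel W 1).formalLog.subst (C (D.c : ℚ) * z) := by
          rw [hcc, one_mul]
      _ = C (D.c : ℚ) * lSeriesLog a := by rw [mul_assoc, ← h]
  have hz₂0 : constantCoeff z₂ = 0 := by
    rw [hz₂, hι, ← coeff_zero_eq_constantCoeff, coeff_map, coeff_zero_eq_constantCoeff, hz0, map_zero]
  have hD₂0 : constantCoeff D₂ = 0 := by rw [hD₂, map_mul, hz₂0, mul_zero]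
  have hL₂0 : constantCoeff L₂ = 0 := by
    rw [hL₂, hι, ← coeff_zero_eq_constantCoeff, coeff_map, lSeriesLog, coeff_mk]; simp
  have hlog2 : (V.map PadicInt.Coe.ringHom).formalLog.subst D₂ = C ((D.c : ℚ) : ℚ_[2]) * L₂ := by
    have h := congrArg ι hlog1
    rw [hι, map_subst_apply (HasSubst.of_constantCoeff_zero' hcz0), map_formalLog, ← hVE, map_mul,
      map_C, map_mul, map_C, hrat] at h
    exact h
  -- §D: halving
  have hcc' : ((D.c : ℚ) : ℚ_[2]) = 2 * ((c' : ℚ) : ℚ_[2]) := by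
    rw [hc']; push_cast; ring
  set s : ℚ_[2]⟦X⟧ := (V.map PadicInt.Coe.ringHom).formalExp.subst (C ((c' : ℚ) : ℚ_[2]) * L₂) with hs
  have hDs : D₂ = ((V.map PadicInt.Coe.ringHom).formalMul 2).subst s :=
    eq_formalMul_two_subst_formalExp_of_formalLog_subst (V.map PadicInt.Coe.ringHom) hD₂0 hL₂0 hcc' hlog2
  have hu0 : constantCoeff (C ((c' : ℚ) : ℚ_[2]) * L₂) = 0 := by rw [map_mul, hL₂0, mul_zero]
  have hs0 : constantCoeff s = 0 := by
    rw [hs, Literature.RingTheory.FormalGroups.constantCoeff_subst_of_constantCoeff_eq_zero hu0,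
      constantCoeff_formalExp]
  -- §E: the square identity on `E♮`
  have hsq := formalXMulSq_formalMul_two_sub_root_mul_sq V rfl rfl heroot₂ hs0
  rw [← hDs] at hsq
  -- §F: the Kummer series read on `E♮ ⊗ ℚ₂`
  have hΞ : ι (kummerSeries W D.c e z) =
      (V.map PadicInt.Coe.ringHom).formalXMulSq.subst D₂ - C e₂ * D₂ ^ 2 := by
    have h1 : ι ((shortModel W D.c).formalXMulSq.subst z) =
        (V.map PadicInt.Coe.ringHom).formalXMulSq.subst D₂ := by
      rw [formalXMulSq_shortModel_subst W hc0 hz0, hι,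
        map_subst_apply (HasSubst.of_constantCoeff_zero' hcz0), map_formalXMulSq, ← hVE, map_mul, map_C,
        hrat]
    have h2 : ι (shortRoot W D.c e • z ^ 2) = C e₂ * D₂ ^ 2 := by
      have hsc : algebraMap ℚ ℚ_[2] (shortRoot W D.c e) = e₂ * ((D.c : ℚ) : ℚ_[2]) ^ 2 := by
        rw [he₂, heQ, hrat, hrat]
        simp only [shortRoot]
        push_cast
        ring
      rw [smul_eq_C_mul, map_mul, map_pow, hι, map_C, hsc, hD₂]
      simp only [map_mul, map_pow]
      ring
    rw [kummerSeries, map_sub, h1, h2]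
  -- §G: integrality of the witnesses
  have hL₂int : IsPadicInt L₂ := by
    rw [isPadicInt_iff_coeff]
    intro n
    rw [hL₂, hι, coeff_map, lSeriesLog, coeff_mk, hrat]
    by_cases hn0 : n = 0
    · subst hn0; simp
    rcases Nat.even_or_odd n with hev | hodd
    · rw [han n, lFunction_eq_zero_of_even W ha2 hN2 hn0 (even_iff_two_dvd.mp hev)]
      simp
    · push_cast
      rw [div_eq_mul_inv, norm_mul, padicTwo_norm_inv_natCast_of_odd hodd, mul_one]
      exact Padic.norm_int_le_one _
  have hc'int : IsPadicInt (C ((c' : ℚ) : ℚ_[2]) : ℚ_[2]⟦X⟧) := by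
    rw [Rat.cast_intCast]
    exact IsPadicInt.powerSeries_C (Padic.norm_int_le_one _)
  have hsint : IsPadicInt s :=
    (isPadicInt_formalExp_of_a₁_a₃_two V rfl rfl).powerSeries_subst (hc'int.mul hL₂int)
      (HasSubst.of_constantCoeff_zero' hu0)
  have hss : HasSubst s := HasSubst.of_constantCoeff_zero' hs0
  have hXsint : IsPadicInt ((V.map PadicInt.Coe.ringHom).formalXMulSq.subst s) := by
    rw [← map_formalXMulSq]; exact (isPadicInt_map _).powerSeries_subst hsint hss
  have hDint : IsPadicInt D₂ := by
    rw [hDs, ← map_formalMul]; exact (isPadicInt_map _).powerSeries_subst hsint hss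
  have he₂int : IsPadicInt (C e₂ : ℚ_[2]⟦X⟧) := IsPadicInt.powerSeries_C henorm
  have hδint : IsPadicInt (C (3 * e₂ ^ 2 + 2 * (V.a₂ : ℚ_[2]) * e₂ + (V.a₄ : ℚ_[2])) : ℚ_[2]⟦X⟧) := by
    refine IsPadicInt.powerSeries_C ?_
    have h2 : (V.a₂ : ℚ_[2]) = 0 := by simp [hVdef]
    rw [h2, mul_zero, zero_mul, add_zero]
    refine (Padic.nonarchimedean _ _).trans (max_le ?_ (PadicInt.norm_le_one _))
    rw [norm_mul, norm_pow]
    have h3' : ‖(3 : ℚ_[2])‖ ≤ 1 := by simpa using Padic.norm_int_le_one (p := 2) 3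
    calc ‖(3 : ℚ_[2])‖ * ‖e₂‖ ^ 2 ≤ 1 * 1 ^ 2 := by gcongr
      _ = 1 := by norm_num
  set Xs := (V.map PadicInt.Coe.ringHom).formalXMulSq.subst s with hXs
  set Nn := (Xs - C e₂ * s ^ 2) ^ 2 - C (3 * e₂ ^ 2 + 2 * (V.a₂ : ℚ_[2]) * e₂ + (V.a₄ : ℚ_[2])) * s ^ 4
    with hNn
  have hNint : IsPadicInt Nn :=
    ((hXsint.sub (he₂int.mul (hsint.pow 2))).pow 2).sub (hδint.mul (hsint.pow 4))
  have hAint : IsPadicInt (D₂ * Nn) := hDint.mul hNint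
  have hBint : IsPadicInt (2 * s * Xs) := by
    have h2 : IsPadicInt (2 : ℚ_[2]⟦X⟧) := by
      rw [show (2 : ℚ_[2]⟦X⟧) = C 2 from (map_ofNat C 2).symm]
      exact IsPadicInt.powerSeries_C (by simpa using Padic.norm_int_le_one (p := 2) 2)
    exact (h2.mul hsint).mul hXsint
  obtain ⟨A₁, hA₁⟩ := isPadicInt_iff_exists_powerSeries_map.mp hAint
  obtain ⟨B₁, hB₁⟩ := isPadicInt_iff_exists_powerSeries_map.mp hBint
  -- §H: non-vanishing of `B = 2·s·X(s)`
  have hL₂1 : coeff 1 L₂ = 1 := by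
    rw [hL₂, hι, coeff_map, lSeriesLog, coeff_mk, hrat, han 1, W.isMultiplicative_LFunction.map_one]
    simp
  have hD₂ne : D₂ ≠ 0 := by
    intro h0
    have hsub0 : (V.map PadicInt.Coe.ringHom).formalLog.subst (0 : ℚ_[2]⟦X⟧) = 0 := by
      rw [subst_zero_eq_C_constantCoeff, constantCoeff_formalLog, map_zero, map_zero]
    have h := hlog2
    rw [h0, hsub0] at h
    have h1 := congrArg (coeff 1) h
    rw [map_zero, coeff_C_mul, hL₂1, mul_one] at h1
    exact hc0 (by exact_mod_cast h1.symm)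
  have hsne : s ≠ 0 := fun h0 => hD₂ne <| by
    rw [hDs, h0, subst_zero_eq_C_constantCoeff, constantCoeff_formalMul, map_zero, map_zero]
  have hXsne : Xs ≠ 0 := formalXMulSq_subst_ne_zero (E := V.map PadicInt.Coe.ringHom) hs0
  have h2ne : (2 : ℚ_[2]⟦X⟧) ≠ 0 := fun h => by
    have := congrArg constantCoeff h; rw [map_ofNat, map_zero] at this; exact two_ne_zero this
  have hBne : B₁ ≠ 0 := fun h0 => by
    rw [h0, map_zero] at hB₁; exact (mul_ne_zero (mul_ne_zero h2ne hsne) hXsne) hB₁.symm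
  -- §I: assemble
  refine ⟨A₁, B₁, hBne, ?_⟩
  rw [Subsingleton.elim (Rat.castHom ℚ_[2]) (algebraMap ℚ ℚ_[2]), hA₁, hB₁]
  change ι (kummerSeries W D.c e z) * (2 * s * Xs) ^ 2 = (D₂ * Nn) ^ 2
  rw [hΞ]
  exact hsq

end Main

end Summit.BirchSwinnertonDyer.BirchSwinnertonDyer.Theorems.ManinLocalTwoThree

end
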